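import Summits.BirchSwinnertonDyer.BirchSwinnertonDyer.Theorems.ThetaPartnerAtTwoSignedMainConjectureCMTwoRankZeroFlatTwistMinusUnit
import Literature.NumberTheory.EllipticCurves.ModularCurveMinusPeriodRatio
import HarnessLib

/-!
# Route `AlignedTransportAtTwo`, crux C1 `MainConjectureTransportAlignedAtTwo` (stmt-BirchSwinnertonDyer-22296), line `birth`
# v17, PRINT stub F3⁻ `stub_minusPeriodUnitAtTwo`: the named fact
# `numRealComponents_mul_imaginaryPeriodRat_eq_unit_mul_minusPeriod_two` (`c_∞(W)·|Ω⁻(W)| = u·Ω⁻_f`, `‖u‖₂ = 1`) FOLLOWS FROM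
# Abbes–Ullmo 1996, Thm. A — BOTH signs of `Δ`, exact factor-`2` bookkeeping

HONEST FRAMING (cell `bsd-f1-sign2`, WIDTH-5 attach seat `bsd-line-att-p4` g8; `--supports stmt-BirchSwinnertonDyer-22296 --as helper`).
THEOREMS ONLY (no `def`, no named fact, no `sorry`). BSD is NOT proved; C1 is NOT closed; nothing is discharged UNCONDITIONALLY: the
Manin-constant fact `abbesUllmo_not_dvd_maninConstant_of_not_dvd_level` (Abbes–Ullmo 1996 Thm. A in lattice form) is displayed as the
hypothesis `hAU` and is NOT proved in the tree. What this file shows is that the C1 skeleton's two period stubs — F3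
`realPeriodRat_eq_unit_mul_plusPeriod_two` (already `…AnyPrimeProofs.realPeriodRat_eq_unit_mul_plusPeriod_two_fact_of_abbesUllmo`) and F3⁻
`numRealComponents_mul_imaginaryPeriodRat_eq_unit_mul_minusPeriod_two` (this file) — rest on ONE printed theorem (`periodUnitsAtTwo_of_abbesUllmo`).

The `Δ < 0` half of F3⁻ (`c_∞ = 1`) is the tree's `FlatTwist.Imaginary.imaginaryPeriodRat_eq_unit_mul_minusPeriod_two_of_abbesUllmo`
(route `ThetaPartnerAtTwo`, `Δ(W) < 0` only: there the optimal curve's lattice is rhombic and `|Ω⁻(E₀)| = |c₀|·Ω⁻_f`). NEW here is the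
RECTANGULAR half `Δ > 0` (`c_∞ = 2`), where the factor `2` is genuine and must be carried exactly:
* §1 `exists_im_eq_int_mul_imaginaryPeriodRat_of_Δ_pos` — for `Δ(W) > 0` the Néron lattice is rectangular and **`im Λ_E ⊆ ℤ·|Ω⁻(W)|`**
  (not merely `ℤ·|Ω⁻|/2`): the rotated lattice `iΛ_E` is real with the SAME discriminant sign (`g₂(iΛ) = g₂(Λ)`, `g₃(iΛ) = −g₃(Λ)`),
  its least real period is `|Ω⁻(W)|`, and `re(iz) = −im z`; apply the tree's rectangular lemma `IsReal.exists_re_eq_int_mul_of_discr_pos`.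
* §2 `two_mul_imaginaryPeriodRat_eq_abs_mul_minusPeriod_of_latticeEq_of_Δ_pos` — for a lattice-optimal datum (`Λ_{E₀} = c₀Λ_f`) with
  `Δ(E₀) > 0`: **`2·|Ω⁻(E₀)| = |c₀|·Ω⁻_f` EXACTLY** (`i|Ω⁻| ∈ Λ_{E₀}` gives `|Ω⁻| = c₀ j Ω⁻_f/2`; `c₀·(Ω⁻_f/2) ∈ im Λ_{E₀} = ℤ|Ω⁻|` by §1
  gives `c₀Ω⁻_f/2 = k|Ω⁻|`; so `jk = 1`).
* §3 `exists_unit_mul_minusPeriod_two_of_delta_pos` — `W` globally minimal, `E[2]` irreducible, `Δ(W) > 0`, `2 ∤ c₀` ⇒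
  `2·|Ω⁻(W)| = u·Ω⁻_f`, `u = a|c₀|/q`, `‖u‖₂ = 1` (odd-degree isogeny to the optimal curve, which then also has `Δ > 0` by the tree's
  `numRealComponents_eq_of_isogeny_odd`; `q|Ω⁻(W)| = a|Ω⁻(E₀)|` by `exists_int_mul_imaginaryPeriodRat_eq_of_isogeny`).
* §4 **`numRealComponents_mul_imaginaryPeriodRat_eq_unit_mul_minusPeriod_two_of_abbesUllmo :
  abbesUllmo_not_dvd_maninConstant_of_not_dvd_level → numRealComponents_mul_imaginaryPeriodRat_eq_unit_mul_minusPeriod_two`**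
  (case split on the sign of `Δ`), and `periodUnitsAtTwo_of_abbesUllmo` (F3 ∧ F3⁻ from `hAU`).

References: [GreenbergVatsal2000] §3 Rem. 3.4; [AbbesUllmo1996] Thm. A; [EdixhovenManin1991] Prop. 2, §1; [CremonaAlgorithms1997] §2.8
(p. 26), §2.10 (pp. 29–30); [Lawden1989] §§6.15–6.16; [Pal2012] p. 1514.
-/

set_option autoImplicit false
-- the route's Theorems namespace repeats a component by design (summit = sub-problem, D-0017).
set_option linter.dupNamespace false

noncomputable section

open scoped Classical MatrixGroups ModularForm

open Complex CongruenceSubgroup WeierstrassCurve Literature.NumberTheory.EllipticCurves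
  Literature.NumberTheory.EllipticCurves.ModularForms Literature.NumberTheory.EllipticCurves.SkinnerUrban2014 PeriodPair
  Summit.BirchSwinnertonDyer.BirchSwinnertonDyer.Theorems.FlatTwist.Imaginary

namespace Summit.BirchSwinnertonDyer.BirchSwinnertonDyer.Theorems.AlignedTransportAtTwoMinusPeriodUnitAtTwo

/-- For an integer `z` not divisible by `2`, `‖z‖₂ = 1`. [folklore] -/
private theorem padicNorm_intCast_eq_one_of_not_two_dvd' {z : ℤ} (h : ¬ (2 : ℤ) ∣ z) : ‖(z : ℚ_[2])‖ = 1 :=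
  le_antisymm (Padic.norm_int_le_one z)
    (not_lt.mp fun hlt ↦ h (by exact_mod_cast (Padic.norm_intCast_lt_one_iff (p := 2)).mp hlt))

section Lattice

variable {W : WeierstrassCurve ℚ} [W.IsElliptic] {N : ℕ} [NeZero N]

/-! ## §1. Rectangular lattices: `im Λ_E ⊆ ℤ·|Ω⁻(W)|` when `Δ(W) > 0` -/

/-- **For `Δ(W) > 0`, `im z ∈ ℤ·|Ω⁻(W)|` for every period `z ∈ Λ_E`** (rectangular Néron lattice `Λ_E = ℤΩ₀ ⊕ ℤ·i|Ω⁻|`).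
Proof through the rotated lattice `iΛ_E`: it is real, `g₂(iΛ) = i⁻⁴g₂ = g₂`, `g₃(iΛ) = i⁻⁶g₃ = −g₃` so its discriminant is again
positive, its least positive real period is `|Ω⁻(W)|` (`imaginaryPeriodRat_eq_minRealPeriod_mulLeft_I`), and `re(iz) = −im z`; the
tree's `IsReal.exists_re_eq_int_mul_of_discr_pos` (Lawden §6.16, rectangular case) applies to `iz ∈ iΛ_E`.
[cite: Lawden1989, §6.16] [cite: CremonaAlgorithms1997, §2.8 (p. 26)] -/
theorem exists_im_eq_int_mul_imaginaryPeriodRat_of_Δ_pos (D : ModularParametrizationData W N) (hΔ : 0 < W.Δ) {z : ℂ}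
    (hz : z ∈ D.L.lattice) : ∃ k : ℤ, z.im = k * W.imaginaryPeriodRat := by
  have hR : D.L.IsReal := D.isReal_neronLattice
  have hR' : (D.L.mulLeft I I_ne_zero).IsReal := hR.mulLeft_I
  have hdisc : 0 < D.L.g₂.re ^ 3 - 27 * D.L.g₃.re ^ 2 := by
    rw [D.discr_neronLattice]
    have e : (W.baseChange ℝ).Δ = (W.Δ : ℝ) := by simp [WeierstrassCurve.baseChange, WeierstrassCurve.map_Δ]
    rw [e]
    exact_mod_cast hΔ
  have h4 : (I : ℂ) ^ 4 = 1 := by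
    rw [show (4 : ℕ) = 2 * 2 from rfl, pow_mul, Complex.I_sq]; norm_num
  have h6 : (I : ℂ) ^ 6 = -1 := by
    rw [show (6 : ℕ) = 2 * 3 from rfl, pow_mul, Complex.I_sq]; norm_num
  have hg₂ : (D.L.mulLeft I I_ne_zero).g₂ = D.L.g₂ := by rw [g₂_mulLeft, h4, inv_one, one_mul]
  have hg₃ : (D.L.mulLeft I I_ne_zero).g₃ = -D.L.g₃ := by rw [g₃_mulLeft, h6]; norm_num
  have hdisc' : 0 < (D.L.mulLeft I I_ne_zero).g₂.re ^ 3 - 27 * (D.L.mulLeft I I_ne_zero).g₃.re ^ 2 := by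
    rw [hg₂, hg₃, Complex.neg_re, neg_sq]
    exact hdisc
  have hz' : I * z ∈ (D.L.mulLeft I I_ne_zero).lattice := by
    rw [mem_mulLeft_lattice, ← mul_assoc, inv_mul_cancel₀ I_ne_zero, one_mul]
    exact hz
  obtain ⟨k, hk⟩ := hR'.exists_re_eq_int_mul_of_discr_pos hdisc' hz'
  rw [← imaginaryPeriodRat_eq_minRealPeriod_mulLeft_I D] at hk
  have hre : (I * z).re = -z.im := by simp [Complex.mul_re]
  rw [hre] at hk
  exact ⟨-k, by push_cast; linarith⟩

/-! ## §2. The optimal curve with `Δ > 0`: `2·|Ω⁻(E₀)| = |c₀|·Ω⁻_f` exactly -/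

/-- **`2·|Ω⁻(E₀)| = |c₀|·Ω⁻_f` for a lattice-optimal datum with `Δ(E₀) > 0`** (rectangular lattice; the factor `m ∣ 2` of the tree's
`exists_dvd_two_mul_imaginaryPeriodRat_eq_of_latticeEq` is `2` here, cf. `imaginaryPeriodRat_eq_abs_mul_minusPeriod_of_latticeEq` for
`Δ ≤ 0` where it is `1`). With `Λ_{E₀} = c₀Λ_f` and `im Λ_f = ℤ·Ω⁻_f/2`: `i|Ω⁻| ∈ Λ_{E₀}` gives `|Ω⁻| = c₀ j Ω⁻_f/2`, and
`Ω⁻_f/2 = im w'` with `c₀w' ∈ Λ_{E₀}` gives `c₀Ω⁻_f/2 = k|Ω⁻|` with `k ∈ ℤ` by §1; hence `jk = 1`, `|j| = 1`.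
[cite: EdixhovenManin1991, Prop. 2 and §1] [cite: CremonaAlgorithms1997, §2.8 (p. 26) and §2.10 (pp. 29–30)] -/
theorem two_mul_imaginaryPeriodRat_eq_abs_mul_minusPeriod_of_latticeEq_of_Δ_pos (D₀ : ModularParametrizationData W N)
    (hopt : ∀ z ∈ D₀.L.lattice, ∃ w ∈ periodLattice D₀.f, z = D₀.c * w) (hΔ : 0 < W.Δ) :
    2 * W.imaginaryPeriodRat = |(D₀.c : ℝ)| * minusPeriod D₀.f := by
  have hminus : 0 < minusPeriod D₀.f :=
    IsNewform0.minusPeriod_pos_holds D₀.isNewformOf.1 D₀.isNewformOf.coeffField_eq_bot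
  have him : imagPeriods D₀.f = AddSubgroup.zmultiples (minusPeriod D₀.f / 2) :=
    SkinnerUrban2014.imagPeriods_eq_zmultiples_of_minusPeriod_pos D₀.f hminus
  set Ω₁ := W.imaginaryPeriodRat with hΩ₁
  have hpos : 0 < Ω₁ := W.imaginaryPeriodRat_pos
  -- (i) `iΩ₁ = c₀ w`, `w ∈ Λ_f`: `Ω₁ = c₀ · im w`, `im w = j Ω⁻_f/2`
  obtain ⟨w, hw, hΩw⟩ := hopt _ (I_mul_imaginaryPeriodRat_mem D₀)
  have hwim : w.im ∈ imagPeriods D₀.f := by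
    rw [imagPeriods, AddSubgroup.mem_map]
    exact ⟨w, hw, rfl⟩
  rw [him, AddSubgroup.mem_zmultiples_iff] at hwim
  obtain ⟨j, hj⟩ := hwim
  have h1 : Ω₁ = D₀.c * w.im := by
    have := congrArg Complex.im hΩw
    simpa using this
  -- (ii) `Ω⁻_f/2 = im w'`, `c₀ w' ∈ Λ_{E₀}`, so `c₀ Ω⁻_f/2 = k Ω₁` with `k ∈ ℤ` (§1, rectangular)
  have hmem : minusPeriod D₀.f / 2 ∈ imagPeriods D₀.f := by
    rw [him]
    exact AddSubgroup.mem_zmultiples _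
  rw [imagPeriods, AddSubgroup.mem_map] at hmem
  obtain ⟨w', hw', hw'im⟩ := hmem
  have hw'im' : w'.im = minusPeriod D₀.f / 2 := by simpa using hw'im
  have hcw' : (D₀.c : ℂ) * w' ∈ D₀.L.lattice := D₀.smul_periodLattice_le w' hw'
  obtain ⟨k, hk⟩ := exists_im_eq_int_mul_imaginaryPeriodRat_of_Δ_pos D₀ hΔ hcw'
  have hmul : ((D₀.c : ℂ) * w').im = (D₀.c : ℝ) * w'.im := by simp [Complex.mul_im]
  have h2 : (D₀.c : ℝ) * (minusPeriod D₀.f / 2) = k * Ω₁ := by rw [← hw'im', ← hmul, hk]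
  -- `jk = 1`
  have e1 : Ω₁ = D₀.c * (j * (minusPeriod D₀.f / 2)) := by rw [h1, ← hj, zsmul_eq_mul]
  have hjk : (j : ℝ) * k = 1 := by
    have e2 : Ω₁ * (j * k) = Ω₁ * 1 := by
      calc Ω₁ * (j * k) = j * ((D₀.c : ℝ) * (minusPeriod D₀.f / 2)) * 1 := by rw [h2]; ring
        _ = Ω₁ * 1 := by rw [e1]; ring
    exact mul_left_cancel₀ hpos.ne' e2
  have hjk' : j * k = 1 := by exact_mod_cast hjk
  have hj1 : |(j : ℝ)| = 1 := by
    rcases Int.eq_one_or_neg_one_of_mul_eq_one hjk' with rfl | rfl <;> simp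
  -- `2Ω₁ = c₀ j Ω⁻_f`, take absolute values
  have e3 : 2 * Ω₁ = (D₀.c : ℝ) * j * minusPeriod D₀.f := by rw [e1]; ring
  calc 2 * Ω₁ = |2 * Ω₁| := (abs_of_pos (by positivity)).symm
    _ = |(D₀.c : ℝ)| * |(j : ℝ)| * |minusPeriod D₀.f| := by rw [e3, abs_mul, abs_mul]
    _ = |(D₀.c : ℝ)| * minusPeriod D₀.f := by rw [hj1, mul_one, abs_of_pos hminus]

/-! ## §3. `Δ(W) > 0`, `E[2]` irreducible, `2 ∤ c₀` ⇒ `2·|Ω⁻(W)| = u·Ω⁻_f`, `‖u‖₂ = 1` -/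

/-- **The minus-period unit at `p = 2` for `Δ(W) > 0`, modulo the Manin constant of the optimal curve.** `W/ℚ` globally minimal,
`E[2]` irreducible, `Δ(W) > 0`, `f` the newform of `W`, and (`hc`) `2 ∤ c₀` for the lattice-optimal datum at the level of `f` ⟹
`2·|Ω⁻(W)| = u·Ω⁻_f`, `u = a|c₀|/q ∈ ℚ`, `‖u‖₂ = 1`: optimal datum `D₀` on a globally minimal `W₀ ~ W`
(`exists_optimalDatum_of_edixhoven`), an isogeny `W → W₀` of ODD degree (`exists_isogeny_not_dvd_degree_of_irreducible`), so
`Δ(W₀) > 0` as well (`numRealComponents_eq_of_isogeny_odd`), `q|Ω⁻(W)| = a|Ω⁻(W₀)|` with `q, a` odd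
(`exists_int_mul_imaginaryPeriodRat_eq_of_isogeny`), and §2. Twin of the tree's `exists_unit_mul_minusPeriod_two_of_delta_neg`.
[cite: GreenbergVatsal2000, §3, Remark 3.4] [cite: EdixhovenManin1991, Prop. 2 and §1] -/
theorem exists_unit_mul_minusPeriod_two_of_delta_pos (W : WeierstrassCurve ℚ) [W.IsElliptic] [W.IsGloballyMinimal]
    (hirr : W.HasIrreducibleModPGaloisRep 2) (hΔ : 0 < W.Δ) (f : CuspForm (Gamma0 N) 2) (hf : IsNewformOf W f)
    (hc : ∀ (W₀ : WeierstrassCurve ℚ) [W₀.IsElliptic] [W₀.IsGloballyMinimal]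
      (D₀ : ModularParametrizationData W₀ N), D₀.f = f →
      (∀ z ∈ D₀.L.lattice, ∃ w ∈ periodLattice D₀.f, z = D₀.c * w) → ¬ (2 : ℤ) ∣ D₀.maninConstant) :
    ∃ u : ℚ, ‖(u : ℚ_[2])‖ = 1 ∧ 2 * W.imaginaryPeriodRat = u * minusPeriod f := by
  haveI : Fact (Nat.Prime 2) := ⟨Nat.prime_two⟩
  obtain ⟨D⟩ := Literature.NumberTheory.Automorphic.nonempty_modularParametrizationData_of_isNewformOf hf
  have hDf : D.f = f := D.isNewformOf.unique hf
  subst hDf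
  obtain ⟨W₀, hW₀, hW₀', D₀, hf₀, hiso, hopt, -⟩ :=
    D.exists_optimalDatum_of_edixhoven
      (fun hf' hL' q hq hq' ↦ edixhoven_int_of_neronLattice_eq_smul_periodLattice_holds hf' hL' q hq hq')
  have hc₀ : ¬ (2 : ℤ) ∣ D₀.c := hc W₀ D₀ hf₀ hopt
  obtain ⟨ψ, hψ⟩ := exists_isogeny_not_dvd_degree_of_irreducible (W := W) (W' := W₀)
    (by norm_num : ((2 : ℕ) : ℚ) ≠ 0) hirr hiso
  obtain ⟨q, a, b, hq0, hqd, hab, hqa⟩ := exists_int_mul_imaginaryPeriodRat_eq_of_isogeny D D₀ ψ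
  -- `Δ(W₀) > 0` as well
  have hodd : Odd ψ.degree := Nat.odd_iff.mpr (Nat.two_dvd_ne_zero.mp hψ)
  have hn := numRealComponents_eq_of_isogeny_odd D D₀ ψ hodd
  have hΔ₀ : 0 < W₀.Δ := by
    by_contra h
    rw [W.numRealComponents_baseChange_real, W₀.numRealComponents_baseChange_real, if_pos hΔ, if_neg h] at hn
    exact absurd hn (by decide)
  have hm := two_mul_imaginaryPeriodRat_eq_abs_mul_minusPeriod_of_latticeEq_of_Δ_pos D₀ hopt hΔ₀
  rw [hf₀] at hm
  have hq0' : (q : ℝ) ≠ 0 := by exact_mod_cast hq0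
  have hpa : ¬ (2 : ℤ) ∣ a := fun h ↦ hψ (Int.natCast_dvd_natCast.mp (hab ▸ h.mul_right b))
  have hpq : ¬ (2 : ℤ) ∣ q := fun h ↦ hψ (Int.natCast_dvd_natCast.mp (h.trans hqd))
  have hpc : ¬ (2 : ℤ) ∣ |D₀.c| := fun h ↦ hc₀ ((dvd_abs _ _).mp h)
  refine ⟨((a : ℚ) * (|D₀.c| : ℤ)) / (q : ℚ), ?_, ?_⟩
  · have e : ((((a : ℚ) * (|D₀.c| : ℤ)) / (q : ℚ) : ℚ) : ℚ_[2]) =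
        ((a : ℚ_[2]) * ((|D₀.c| : ℤ) : ℚ_[2])) / (q : ℚ_[2]) := by
      simp only [Rat.cast_div, Rat.cast_mul, Rat.cast_intCast]
    rw [e, norm_div, norm_mul, padicNorm_intCast_eq_one_of_not_two_dvd' hpa,
      padicNorm_intCast_eq_one_of_not_two_dvd' hpc, padicNorm_intCast_eq_one_of_not_two_dvd' hpq]
    norm_num
  · rw [← Int.cast_abs] at hm
    have h1 : 2 * W.imaginaryPeriodRat * (q : ℝ) = ((a : ℝ) * ((|D₀.c| : ℤ) : ℝ)) * minusPeriod D.f := by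
      calc 2 * W.imaginaryPeriodRat * (q : ℝ) = 2 * ((q : ℝ) * W.imaginaryPeriodRat) := by ring
        _ = 2 * (a * W₀.imaginaryPeriodRat) := by rw [hqa]
        _ = a * (2 * W₀.imaginaryPeriodRat) := by ring
        _ = ((a : ℝ) * ((|D₀.c| : ℤ) : ℝ)) * minusPeriod D.f := by rw [hm]; ring
    have hcast : ((((a : ℚ) * (|D₀.c| : ℤ)) / (q : ℚ) : ℚ) : ℝ) =
        ((a : ℝ) * ((|D₀.c| : ℤ) : ℝ)) / (q : ℝ) := by
      simp only [Rat.cast_div, Rat.cast_mul, Rat.cast_intCast]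
    rw [hcast, div_mul_eq_mul_div, eq_div_iff hq0']
    exact h1

end Lattice

/-! ## §4. The named fact F3⁻ at `2`, both signs of `Δ`, from Abbes–Ullmo 1996 Thm. A -/

/-- **`c_∞(W)·|Ω⁻(W)| = u·Ω⁻_f`, `‖u‖₂ = 1`, for `W` good at `2` with `E[2]` irreducible, from Abbes–Ullmo** (named fact
`abbesUllmo_not_dvd_maninConstant_of_not_dvd_level`, displayed as `hAU`, NOT discharged). Case `Δ < 0` (`c_∞ = 1`): the tree's
`imaginaryPeriodRat_eq_unit_mul_minusPeriod_two_of_abbesUllmo`; case `Δ > 0` (`c_∞ = 2`): §3 with `2 ∤ N`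
(`not_dvd_level_of_hasGoodReductionAtPrime`). [cite: AbbesUllmo1996, Thm. A] [cite: GreenbergVatsal2000, §3, Remark 3.4]
[cite: Pal2012, p. 1514] -/
theorem exists_unit_numRealComponents_mul_imaginaryPeriodRat_two_of_abbesUllmo
    (hAU : abbesUllmo_not_dvd_maninConstant_of_not_dvd_level) (W : WeierstrassCurve ℚ) [W.IsElliptic] [W.IsGloballyMinimal]
    (hgood : W.HasGoodReductionAtPrime 2) (hirr : W.HasIrreducibleModPGaloisRep 2) {N : ℕ} [NeZero N]
    (f : CuspForm (Gamma0 N) 2) (hf : IsNewformOf W f) :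
    ∃ u : ℚ, ‖(u : ℚ_[2])‖ = 1 ∧ ((W.baseChange ℝ).numRealComponents : ℝ) * W.imaginaryPeriodRat = u * minusPeriod f := by
  haveI : Fact (Nat.Prime 2) := ⟨Nat.prime_two⟩
  have h2N : ¬ 2 ∣ N := not_dvd_level_of_hasGoodReductionAtPrime hgood hf
  have hc : ∀ (W₀ : WeierstrassCurve ℚ) [W₀.IsElliptic] [W₀.IsGloballyMinimal] (D₀ : ModularParametrizationData W₀ N),
      D₀.f = f → (∀ z ∈ D₀.L.lattice, ∃ w ∈ periodLattice D₀.f, z = D₀.c * w) → ¬ (2 : ℤ) ∣ D₀.maninConstant :=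
    fun W₀ _ _ D₀ _ hopt ↦ by exact_mod_cast hAU W₀ D₀ hopt 2 Nat.prime_two h2N
  rw [W.numRealComponents_baseChange_real]
  by_cases hΔ : 0 < W.Δ
  · rw [if_pos hΔ]
    obtain ⟨u, hu, h⟩ := exists_unit_mul_minusPeriod_two_of_delta_pos W hirr hΔ f hf hc
    exact ⟨u, hu, by push_cast; exact h⟩
  · rw [if_neg hΔ]
    have hΔ' : W.Δ < 0 := lt_of_le_of_ne (not_lt.mp hΔ) (W.isUnit_Δ.ne_zero)
    obtain ⟨u, hu, h⟩ := imaginaryPeriodRat_eq_unit_mul_minusPeriod_two_of_abbesUllmo hAU W hgood hirr hΔ' f hf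
    exact ⟨u, hu, by push_cast; rw [one_mul]; exact h⟩

/-- **The named fact `numRealComponents_mul_imaginaryPeriodRat_eq_unit_mul_minusPeriod_two` (`ModularCurveMinusPeriodRatio.lean`,
"Size L; no `_holds`"; the C1 skeleton's PRINT stub F3⁻ `stub_minusPeriodUnitAtTwo`) BY NAME, from Abbes–Ullmo 1996 Thm. A alone.**
So the planner/lead may trade the stub F3⁻ (a Greenberg–Vatsal-Remark-3.4-at-`2` reading, "weaker than the sources") for the single
lattice-form Manin-constant fact `abbesUllmo_not_dvd_maninConstant_of_not_dvd_level`, which also yields F3 (`periodUnitsAtTwo_of_abbesUllmo`).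
[cite: AbbesUllmo1996, Thm. A] [cite: GreenbergVatsal2000, §3, Remark 3.4] [cite: EdixhovenManin1991, Prop. 2 and §1] -/
theorem numRealComponents_mul_imaginaryPeriodRat_eq_unit_mul_minusPeriod_two_of_abbesUllmo
    (hAU : abbesUllmo_not_dvd_maninConstant_of_not_dvd_level) :
    numRealComponents_mul_imaginaryPeriodRat_eq_unit_mul_minusPeriod_two := by
  intro W _ _ hgood hirr N _ f hf
  exact exists_unit_numRealComponents_mul_imaginaryPeriodRat_two_of_abbesUllmo hAU W hgood hirr f hf

/-- **Both period stubs of the C1 skeleton from ONE printed theorem**: Abbes–Ullmo 1996 Thm. A (lattice form) gives F3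
`realPeriodRat_eq_unit_mul_plusPeriod_two` (tree: `realPeriodRat_eq_unit_mul_plusPeriod_two_fact_of_abbesUllmo`) and F3⁻
`numRealComponents_mul_imaginaryPeriodRat_eq_unit_mul_minusPeriod_two` (this file). [cite: AbbesUllmo1996, Thm. A]
[cite: GreenbergVatsal2000, §3, Remark 3.4] -/
theorem periodUnitsAtTwo_of_abbesUllmo (hAU : abbesUllmo_not_dvd_maninConstant_of_not_dvd_level) :
    realPeriodRat_eq_unit_mul_plusPeriod_two ∧ numRealComponents_mul_imaginaryPeriodRat_eq_unit_mul_minusPeriod_two :=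
  ⟨realPeriodRat_eq_unit_mul_plusPeriod_two_fact_of_abbesUllmo hAU,
    numRealComponents_mul_imaginaryPeriodRat_eq_unit_mul_minusPeriod_two_of_abbesUllmo hAU⟩

end Summit.BirchSwinnertonDyer.BirchSwinnertonDyer.Theorems.AlignedTransportAtTwoMinusPeriodUnitAtTwo

end
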